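import Summits.CriticalPhenomena.CardyFormulaZ2.Theorems.CardyBoundaryCoulombGasHalfPlaneMarkDensityLawDensityIntegral
import Summits.CriticalPhenomena.CardyFormulaZ2.Theorems.CardyBoundaryCoulombGasHalfPlaneMarkDensityLawWiredCardy
import Summits.CriticalPhenomena.CardyFormulaZ2.Theorems.CardyBoundaryCoulombGasHalfPlaneMarkDensityLawSelfDualityAssembly

/-!
# `HalfPlaneMarkDensityLaw` (crux stmt-CriticalPhenomena-5661, route CardyBoundaryCoulombGas), line `Sketch`:
# the constant of the mark density law is NOT free — self-duality pins it (lead c6-0)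

The crux asserts `n · P_{1/2}[E_n(a,b,c,x)] → (cardyConst/3)·((b−a)(c−b)(c−a))^{1/3}·((x−a)(x−b)(x−c))^{−2/3}`
and its informal description adds "with NO free constant".  This file makes that remark a theorem
about bond-`ℤ²` at `p = 1/2`, with the correct mechanism on `ℤ×ℕ` (self-duality, not total mass: the law
of the `c`-most point on `(c,∞)` has mass `F((b−a)/(c−a)) < 1`):

* `NoFreeConstant.jointLimit_eq` — if the law holds with SOME constant, i.e.
  `lawSeq a b c x → λ · density a b c x` on the chamber, then every joint subsequential limit `G` of the
  collinear half-plane crossing function (c2-0, `Subseq.exists_jointSubseqLimit`) is `λ · F∘η`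
  (c4-0's `hasDerivAt_jointLimit`: the limit of the crux's sequence along the subsequence IS `∂₄G`;
  Cardy's `Φ = F∘η` has `Φ′ = density` (`hasDerivAt_cardy_crossRatio`); `G − λΦ` has zero derivative
  on `(c,∞)` and tends to `0` at `c⁺`);
* `NoFreeConstant.tendsto_wired_subseq` — the wired three-mark kernel then tends to `λ·F(x/(x+σ))`
  along the subsequence (the sandwich of `WiredCardy.tendsto_wired`, run along `θ`);
* `NoFreeConstant.lam_eq_one` — c3-0's duality–reflection law `P_n(σ,x) + P_n(x,σ) → 1`
  (`SelfDual.selfDualReflection`, stmt-9327) at `σ = x = 1` and `F(1/2) = 1/2`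
  (`cardyFunction_one_sub_holds`) force `λ = 1`;
* `stub_noFreeConstant` (registered extra stub; verbatim the normalisation stub
  `stub_betaNormalisation` of the second line `rank-one-marginality-bootstrap` of this crux) —
  **for every real `C`, if the density law holds with constant `C` in place of `cardyConst/3`, then
  `C = cardyConst/3`**; equivalently (`halfPlaneMarkDensityLaw_iff_exists_constant`) the crux is
  equivalent to its constant-free form;
* `stub_rankOneOfCrux` (registered extra stub) — the load-bearing stub `stub_rankOnePureProduct` of the
  line `rank-one-marginality-bootstrap` (a Coulomb-gas pure product with free charges) FOLLOWS from the
  crux by instantiation (`C = cardyConst/3`, `κ = 1/3`, `e = (1,1,1,−2)`): that line's hard stub is the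
  crux in costume modulo its RSW stubs (lead c6-0's grading, `Cruxes/HalfPlaneMarkDensityLaw/PICKED.md`).
-/

noncomputable section

namespace Summit.CriticalPhenomena.CardyFormulaZ2.Cruxes.HalfPlaneMarkDensityLaw.SketchLine

open Literature.Probability.Percolation Literature.Probability.LatticeModels
open Literature.Probability.RandomPlanarGeometry
open MeasureTheory Filter Set
open scoped Topology
open Summit.CriticalPhenomena.CardyFormulaZ2.Theses.CardyBoundaryCoulombGas (HalfPlaneMarkDensityLaw)
open Summit.CriticalPhenomena.CardyFormulaZ2.Theorems.HalfPlaneMarkDensityLaw.Negative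

namespace NoFreeConstant

/-! ## Step 1: under the law with constant `λ`, every joint limit is `λ · F∘η` -/

section LawWith

variable {lam : ℝ}
  (hlaw : ∀ a b c x : ℝ, a < b → b < c → c < x →
    Tendsto (lawSeq a b c x) atTop (𝓝 (lam * density a b c x)))
include hlaw

/-- **Joint limits under the law with a free constant.** If `lawSeq a b c x → λ·density a b c x` on the
chamber, then every joint subsequential limit `G` of the collinear half-plane crossing function along a
strictly increasing `θ` satisfies `G(a,b,c,y) = λ·F(η(a,b,c,y))` for `a < b < c < y`. [folklore] -/
theorem jointLimit_eq {θ : ℕ → ℕ} (hθ : StrictMono θ) {G : ℝ → ℝ → ℝ → ℝ → ℝ}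
    (hG : ∀ a b c y : ℝ, a < b → b < c → c < y →
      Tendsto (fun n ↦ μ.real (openCrossing halfPlane (arcA a b (θ n))
        (rowIcc ⌊c * (θ n : ℕ)⌋ ⌊y * (θ n : ℕ)⌋))) atTop (𝓝 (G a b c y)))
    {a b c y : ℝ} (hab : a < b) (hbc : b < c) (hcy : c < y) :
    G a b c y = lam * Literature.Probability.RandomPlanarGeometry.cardyFunction (crossRatio ![a, b, c, y]) := by
  -- the difference `φ = G(a,b,c,·) − λΦ` has zero derivative on `(c, ∞)`
  set φ : ℝ → ℝ := fun t ↦ G a b c t - lam * Literature.Probability.RandomPlanarGeometry.cardyFunction (crossRatio ![a, b, c, t]) with hφ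
  have hderiv : ∀ x ∈ Ioi c, HasDerivWithinAt φ (0 : ℝ) (Ioi c) x := by
    intro x hx
    have h1 := Density.hasDerivAt_jointLimit hG hθ.tendsto_atTop hab hbc hx
    have h2 : Tendsto (fun j ↦ lawSeq a b c x (θ j)) atTop (𝓝 (lam * density a b c x)) :=
      (hlaw a b c x hab hbc hx).comp hθ.tendsto_atTop
    have heq : deriv (G a b c) x = lam * density a b c x := tendsto_nhds_unique h1.2 h2
    have hGd : HasDerivAt (G a b c) (lam * density a b c x) x := heq ▸ h1.1
    have hΦd : HasDerivAt (fun t : ℝ ↦ lam * Literature.Probability.RandomPlanarGeometry.cardyFunction (crossRatio ![a, b, c, t])) (lam * density a b c x) x :=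
      (hasDerivAt_cardy_crossRatio hab hbc hx).const_mul lam
    have h := hGd.sub hΦd
    rw [sub_self] at h
    exact h.hasDerivWithinAt
  -- hence `φ` is constant on `(c, ∞)`
  have hconst : ∀ s ∈ Ioi c, ∀ t ∈ Ioi c, φ s = φ t := by
    intro s hs t ht
    have h := (convex_Ioi c).norm_image_sub_le_of_norm_hasDerivWithin_le (C := 0) hderiv
      (fun x _ ↦ by simp) hs ht
    rw [zero_mul, norm_le_zero_iff, sub_eq_zero] at h
    exact h.symm
  -- and `φ → 0` at `c⁺`
  have hlim : Tendsto φ (𝓝[>] c) (𝓝 0) := by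
    have h1 := Density.tendsto_jointLimit_nhdsGT hG hθ hab hbc
    have h2 := (Converse.tendsto_cardy_crossRatio_right a b c hab hbc).const_mul lam
    rw [mul_zero] at h2
    have := h1.sub h2
    rw [sub_zero] at this
    exact this
  -- so the constant is `0`
  have hev : φ =ᶠ[𝓝[>] c] fun _ ↦ φ y := by
    filter_upwards [self_mem_nhdsWithin] with t ht
    exact hconst t ht y hcy
  have hy0 : φ y = 0 := tendsto_nhds_unique (hlim.congr' hev) tendsto_const_nhds |>.symm ▸ rfl
  have : G a b c y - lam * Literature.Probability.RandomPlanarGeometry.cardyFunction (crossRatio ![a, b, c, y]) = 0 := hy0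
  linarith

end LawWith

/-! ## Step 2: the wired kernel along a subsequence -/

/-- **The wired sandwich along a subsequence.** If along a strictly increasing `θ` the collinear
four-mark crossing probabilities converge to `Λ·F∘η` on the chamber, then the wired three-mark kernel
converges along `θ` to `Λ·F(x/(x+σ))` (the sandwich `le_wired`/`wired_le` + escape bound of
`…WiredCardy`, uniform in the scale). [folklore] -/
theorem tendsto_wired_subseq {θ : ℕ → ℕ} (hθ : StrictMono θ) {Λ : ℝ}
    (hC : ∀ a b c y : ℝ, a < b → b < c → c < y →
      Tendsto (fun n ↦ μ.real (openCrossing halfPlane (arcA a b (θ n))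
        (rowIcc ⌊c * (θ n : ℕ)⌋ ⌊y * (θ n : ℕ)⌋))) atTop (𝓝 (Λ * Literature.Probability.RandomPlanarGeometry.cardyFunction (crossRatio ![a, b, c, y]))))
    {σ x : ℝ} (hσ : 0 < σ) (hx : 0 < x) :
    Tendsto (fun n ↦ μ.real (openCrossing halfPlane {v : Site 2 | v 1 = 0 ∧ v 0 ≤ -⌊σ * (θ n : ℕ)⌋}
        {v : Site 2 | v 1 = 0 ∧ 1 ≤ v 0 ∧ v 0 ≤ ⌊x * (θ n : ℕ)⌋})) atTop (𝓝 (Λ * Literature.Probability.RandomPlanarGeometry.cardyFunction (x / (x + σ)))) := by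
  obtain ⟨C, α, _hC0, hα, hesc⟩ := exists_real_boxToFar_le_rpow_of_le_half
  set L := Λ * Literature.Probability.RandomPlanarGeometry.cardyFunction (x / (x + σ)) with hL
  have hX : 1 ≤ ⌈x⌉₊ := Nat.one_le_iff_ne_zero.2 (by simpa using hx)
  refine BoxExhaustion.tendsto_of_sandwich fun ε hε ↦ ?_
  have e1 : ∀ᶠ M : ℕ in atTop, L - ε < Λ * Literature.Probability.RandomPlanarGeometry.cardyFunction (crossRatio ![-(M : ℝ), -σ, (M : ℝ)⁻¹, x]) :=
    ((WiredCardy.tendsto_cardy_lo hσ hx).const_mul Λ) (Ioi_mem_nhds (by linarith))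
  have e2 : ∀ᶠ M : ℕ in atTop, Λ * Literature.Probability.RandomPlanarGeometry.cardyFunction (crossRatio ![-(M : ℝ), -σ + (M : ℝ)⁻¹, 0, x]) < L + ε :=
    ((WiredCardy.tendsto_cardy_hi hσ hx).const_mul Λ) (Iio_mem_nhds (by linarith))
  have e3 : ∀ᶠ M : ℕ in atTop, C * ((⌈x⌉₊ : ℝ) / M) ^ α < ε :=
    (WiredCardy.tendsto_escapeBound C hα ⌈x⌉₊) (Iio_mem_nhds hε)
  have e4 : ∀ᶠ M : ℕ in atTop, (M : ℝ)⁻¹ < min σ x :=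
    (tendsto_inv_atTop_nhds_zero_nat (𝕜 := ℝ)) (Iio_mem_nhds (lt_min hσ hx))
  have e5 : ∀ᶠ M : ℕ in atTop, σ < M := (tendsto_natCast_atTop_atTop (R := ℝ)).eventually_gt_atTop σ
  obtain ⟨M, hM1, hM2, hM3, hM4, hM5, hMX⟩ :=
    (e1.and (e2.and (e3.and (e4.and (e5.and (eventually_ge_atTop ⌈x⌉₊)))))).exists
  have hM : 0 < M := lt_of_lt_of_le (by omega) hMX
  have hM' : (0 : ℝ) < M := by exact_mod_cast hM
  have hMσ : (M : ℝ)⁻¹ < σ := lt_of_lt_of_le hM4 (min_le_left _ _)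
  have hMx : (M : ℝ)⁻¹ < x := lt_of_lt_of_le hM4 (min_le_right _ _)
  refine ⟨fun n ↦ μ.real (openCrossing halfPlane (arcA (-(M : ℝ)) (-σ) (θ n))
      (rowIcc ⌊(M : ℝ)⁻¹ * (θ n : ℕ)⌋ ⌊x * (θ n : ℕ)⌋)),
    fun n ↦ μ.real (openCrossing halfPlane (arcA (-(M : ℝ)) (-σ + (M : ℝ)⁻¹) (θ n))
      (rowIcc ⌊(0 : ℝ) * (θ n : ℕ)⌋ ⌊x * (θ n : ℕ)⌋)), _, _,
    hC _ _ _ _ (by linarith) (by linarith [inv_pos.2 hM']) hMx,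
    hC _ _ _ _ (by linarith [inv_pos.2 hM']) (by linarith) hx, hM1, hM2, ?_⟩
  filter_upwards [eventually_ge_atTop (max M 1)] with n hn
  have hn' : max M 1 ≤ θ n := hn.trans (hθ.id_le n)
  have hnM : M ≤ θ n := le_of_max_le_left hn'
  have hn1 : 1 ≤ θ n := le_of_max_le_right hn'
  refine ⟨WiredCardy.le_wired σ x hM hnM, (WiredCardy.wired_le σ x hM hnM).trans ?_⟩
  have := WiredCardy.escape_le' hesc x hX hMX hn1
  linarith

/-! ## Step 3: self-duality pins the constant -/

/-- `F(1/2) = 1/2` (the duality symmetry `F(1−η) = 1 − F(η)` at `η = 1/2`). [cite: CardyJPhysA1992, after eq. (11)] -/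
theorem cardyFunction_one_half : Literature.Probability.RandomPlanarGeometry.cardyFunction (1 / 2) = 1 / 2 := by
  have h := cardyFunction_one_sub_holds (η := 1 / 2) ⟨by norm_num, by norm_num⟩
  rw [show (1 : ℝ) - 1 / 2 = 1 / 2 by norm_num] at h
  linarith

/-- **Self-duality pins the constant.** If `lawSeq a b c x → λ·density a b c x` on the whole chamber,
then `λ = 1`: along a joint-limit subsequence the wired kernel at `σ = x = 1` tends to `λ·F(1/2) = λ/2`
while the duality–reflection law gives `P_n(1,1) + P_n(1,1) → 1`. [folklore] -/
theorem lam_eq_one {lam : ℝ}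
    (hlaw : ∀ a b c x : ℝ, a < b → b < c → c < x →
      Tendsto (lawSeq a b c x) atTop (𝓝 (lam * density a b c x))) :
    lam = 1 := by
  -- a joint subsequential limit along `θ`
  obtain ⟨θ, hθ, G, hG⟩ := Subseq.exists_jointSubseqLimit (fun n ↦ n) strictMono_id
  -- it is `λ F∘η`
  have hGΛ : ∀ a b c y : ℝ, a < b → b < c → c < y →
      Tendsto (fun n ↦ μ.real (openCrossing halfPlane (arcA a b (θ n))
        (rowIcc ⌊c * (θ n : ℕ)⌋ ⌊y * (θ n : ℕ)⌋))) atTop (𝓝 (lam * Literature.Probability.RandomPlanarGeometry.cardyFunction (crossRatio ![a, b, c, y]))) := by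
    intro a b c y hab hbc hcy
    rw [← jointLimit_eq hlaw hθ hG hab hbc hcy]
    exact hG a b c y hab hbc hcy
  -- wired kernel at `σ = x = 1` along `θ`
  have hw := tendsto_wired_subseq hθ hGΛ one_pos one_pos
  rw [show (1 : ℝ) / (1 + 1) = 1 / 2 by norm_num, cardyFunction_one_half] at hw
  -- self-duality along `θ`
  have hsd := (SelfDual.selfDualReflection 1 1 one_pos one_pos).comp hθ.tendsto_atTop
  have hsum := hw.add hw
  have h := tendsto_nhds_unique hsd hsum
  linarith

end NoFreeConstant

/-- **Registered extra stub `stub_noFreeConstant` of line `Sketch` (= verbatim the normalisation stub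
`stub_betaNormalisation` of line `rank-one-marginality-bootstrap`): the constant of the half-plane mark
density law of bond-`ℤ²` is not free.**  For every real `C`: if
`n · P_{1/2}[E_n(a,b,c,x)] → C·((b−a)(c−b)(c−a))^{1/3}·((x−a)(x−b)(x−c))^{−2/3}` for all `a < b < c < x`,
then `C = cardyConst/3`.  Proof: joint subsequential limits of the CDF are `λF∘η`, `λ = 3C/cardyConst`
(`NoFreeConstant.jointLimit_eq`), the wired kernel follows along the subsequence
(`NoFreeConstant.tendsto_wired_subseq`), and the duality–reflection law `P_n(σ,x)+P_n(x,σ) → 1` with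
`F(1/2) = 1/2` gives `λ = 1` (`NoFreeConstant.lam_eq_one`). [folklore] -/
theorem stub_noFreeConstant :
    ∀ C : ℝ, (∀ a b c x : ℝ, a < b → b < c → c < x → Tendsto (fun n : ℕ ↦ (n : ℝ) * (bondPercolation (zdGraph 2) half).real (openCrossing {v : Site 2 | 0 ≤ v 1} {v | v 1 = 0 ∧ ⌊a * n⌋ ≤ v 0 ∧ v 0 ≤ ⌊b * n⌋} {![⌊x * n⌋, 0]} \ openCrossing {v : Site 2 | 0 ≤ v 1} {v | v 1 = 0 ∧ ⌊a * n⌋ ≤ v 0 ∧ v 0 ≤ ⌊b * n⌋} {v | v 1 = 0 ∧ ⌊c * n⌋ ≤ v 0 ∧ v 0 < ⌊x * n⌋})) atTop (𝓝 (C * ((b - a) * (c - b) * (c - a)) ^ (1 / 3 : ℝ) * ((x - a) * (x - b) * (x - c)) ^ (-(2 / 3) : ℝ)))) → C = cardyConst / 3 := by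
  intro C hC
  have hκ : (0 : ℝ) < cardyConst / 3 := div_pos cardyConst_pos (by norm_num)
  set lam : ℝ := C / (cardyConst / 3) with hlam
  have hlaw : ∀ a b c x : ℝ, a < b → b < c → c < x →
      Tendsto (lawSeq a b c x) atTop (𝓝 (lam * density a b c x)) := by
    intro a b c x hab hbc hcx
    have h := hC a b c x hab hbc hcx
    have e : lam * density a b c x =
        C * ((b - a) * (c - b) * (c - a)) ^ (1 / 3 : ℝ) * ((x - a) * (x - b) * (x - c)) ^ (-(2 / 3) : ℝ) := by
      rw [hlam, density]
      have hc0 : cardyConst ≠ 0 := cardyConst_pos.ne'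
      field_simp
    rw [e]
    exact h
  have h1 := NoFreeConstant.lam_eq_one hlaw
  rw [hlam, div_eq_one_iff_eq hκ.ne'] at h1
  exact h1

/-- **The crux is equivalent to its constant-free form**: `HalfPlaneMarkDensityLaw` holds iff the
density law holds with SOME real constant in place of `cardyConst/3`. [folklore] -/
theorem halfPlaneMarkDensityLaw_iff_exists_constant :
    HalfPlaneMarkDensityLaw ↔ ∃ C : ℝ, ∀ a b c x : ℝ, a < b → b < c → c < x → Tendsto (fun n : ℕ ↦ (n : ℝ) * (bondPercolation (zdGraph 2) half).real (openCrossing {v : Site 2 | 0 ≤ v 1} {v | v 1 = 0 ∧ ⌊a * n⌋ ≤ v 0 ∧ v 0 ≤ ⌊b * n⌋} {![⌊x * n⌋, 0]} \ openCrossing {v : Site 2 | 0 ≤ v 1} {v | v 1 = 0 ∧ ⌊a * n⌋ ≤ v 0 ∧ v 0 ≤ ⌊b * n⌋} {v | v 1 = 0 ∧ ⌊c * n⌋ ≤ v 0 ∧ v 0 < ⌊x * n⌋})) atTop (𝓝 (C * ((b - a) * (c - b) * (c - a)) ^ (1 / 3 : ℝ) * ((x - a) * (x - b) * (x - c)) ^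 (-(2 / 3) : ℝ))) := by
  constructor
  · intro h
    exact ⟨cardyConst / 3, h⟩
  · rintro ⟨C, hC⟩
    have hCeq := stub_noFreeConstant C hC
    subst hCeq
    exact hC

/-- **Registered extra stub `stub_rankOneOfCrux`: the load-bearing stub of line
`rank-one-marginality-bootstrap` follows from the crux.**  `HalfPlaneMarkDensityLaw` implies the
Coulomb-gas pure-product law `stub_rankOnePureProduct` of that line (free constant `C > 0`, coupling `κ`
and charges `e : Fin 4 → ℝ`), by `C = cardyConst/3`, `κ = 1/3`, `e = (1,1,1,−2)`. [folklore] -/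
theorem stub_rankOneOfCrux :
    HalfPlaneMarkDensityLaw → ∃ C κ : ℝ, ∃ e : Fin 4 → ℝ, 0 < C ∧ ∀ a b c x : ℝ, a < b → b < c → c < x → Tendsto (fun n : ℕ ↦ (n : ℝ) * (bondPercolation (zdGraph 2) half).real (openCrossing {v : Site 2 | 0 ≤ v 1} {v | v 1 = 0 ∧ ⌊a * n⌋ ≤ v 0 ∧ v 0 ≤ ⌊b * n⌋} {![⌊x * n⌋, 0]} \ openCrossing {v : Site 2 | 0 ≤ v 1} {v | v 1 = 0 ∧ ⌊a * n⌋ ≤ v 0 ∧ v 0 ≤ ⌊b * n⌋} {v | v 1 = 0 ∧ ⌊c * n⌋ ≤ v 0 ∧ v 0 < ⌊x * n⌋})) atTop (𝓝 (C * (b - a) ^ (κ * e 0 * e 1) * (c - b) ^ (κ * e 1 * e 2) * (c - a) ^ (κ * e 0 * e 2) * (x - a) ^ (κ * e 0 * e 3) * (x - b) ^ (κ * e 1 * e 3) * (x - c) ^ (κ * e 2 * e 3))) := by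
  intro h
  refine ⟨cardyConst / 3, 1 / 3, ![1, 1, 1, -2], div_pos cardyConst_pos (by norm_num),
    fun a b c x hab hbc hcx ↦ ?_⟩
  have hx := h a b c x hab hbc hcx
  have e : cardyConst / 3 * ((b - a) * (c - b) * (c - a)) ^ (1 / 3 : ℝ) *
        ((x - a) * (x - b) * (x - c)) ^ (-(2 / 3) : ℝ) =
      cardyConst / 3 * (b - a) ^ ((1 / 3 : ℝ) * (![1, 1, 1, -2] : Fin 4 → ℝ) 0 * (![1, 1, 1, -2] : Fin 4 → ℝ) 1) *
        (c - b) ^ ((1 / 3 : ℝ) * (![1, 1, 1, -2] : Fin 4 → ℝ) 1 * (![1, 1, 1, -2] : Fin 4 → ℝ) 2) *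
        (c - a) ^ ((1 / 3 : ℝ) * (![1, 1, 1, -2] : Fin 4 → ℝ) 0 * (![1, 1, 1, -2] : Fin 4 → ℝ) 2) *
        (x - a) ^ ((1 / 3 : ℝ) * (![1, 1, 1, -2] : Fin 4 → ℝ) 0 * (![1, 1, 1, -2] : Fin 4 → ℝ) 3) *
        (x - b) ^ ((1 / 3 : ℝ) * (![1, 1, 1, -2] : Fin 4 → ℝ) 1 * (![1, 1, 1, -2] : Fin 4 → ℝ) 3) *
        (x - c) ^ ((1 / 3 : ℝ) * (![1, 1, 1, -2] : Fin 4 → ℝ) 2 * (![1, 1, 1, -2] : Fin 4 → ℝ) 3) := by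
    simp only [Matrix.cons_val_zero, Matrix.cons_val_one, Matrix.head_cons, Matrix.cons_val_two,
      Matrix.tail_cons, Matrix.cons_val_three]
    have hba : 0 ≤ b - a := by linarith
    have hcb : 0 ≤ c - b := by linarith
    have hca : 0 ≤ c - a := by linarith
    have hxa : 0 ≤ x - a := by linarith
    have hxb : 0 ≤ x - b := by linarith
    have hxc : 0 ≤ x - c := by linarith
    rw [Real.mul_rpow (mul_nonneg hba hcb) hca, Real.mul_rpow hba hcb,
      Real.mul_rpow (mul_nonneg hxa hxb) hxc, Real.mul_rpow hxa hxb]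
    norm_num
    ring
  rw [← e]
  exact hx

end Summit.CriticalPhenomena.CardyFormulaZ2.Cruxes.HalfPlaneMarkDensityLaw.SketchLine
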